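import Mathlib
import HarnessLib
import HarnessLib.Audit
import Summits.CriticalPhenomena.Statement
import Literature.Probability.LatticeModels.ScalingLimit3D
import Summits.CriticalPhenomena.Ising3DConformalLimit.Theorems.GaussianScaleMixtureRotationUpgradeFromTwoPoint
import HarnessLib.Audit.Status.Attr

/-!
Route: OrthogonalFrameTP2

DORMANT since 2026-08-29T19:32:58Z (census g0: costume|duplicate of route-CriticalPhenomena-HyperoctahedralRP; reader census-reader-36-g0) — unstaffed, not closed; items shared with open routes are served there. `ledger route dormant <id> --off` reactivates.

# Route OrthogonalFrameTP2 — Pythagoras as a correlation inequality — frame-wise TP₂ of the critical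
two-point function forces O(3)

It suffices to show X = (OLS) ∧ (ROT) ∧ (C) ∧ (D) ∧ (E). (OLS) = CriticalOrthantTP2, the spine card
orthogonal-frames-total-positivity: for all lattice-ORTHOGONAL pairs u ⊥ v in ℤ³ (u·v = 0 over ℤ)
the
kernel (a,b) ↦ G(au − bv), G = ⟨σ₀σ_x⟩⁺ at β_c(3), is log-supermodular (TP₂) on the quadrant ℕ²,
cell
by cell: G((a+1)u−bv)·G(au−(b+1)v) ≤ G(au−bv)·G((a+1)u−(b+1)v) ("crossed sourced currents merge
more"). The deciding theorem consumes (OLS) through its scaling-limit shadow (OLS)∞ =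
LimitOrthantTP2
(crux r7, rev 5): for every admissible limit S (pointwise scaling limit of criticalCorr 3, ρ > 0 on
(0,1], non-degenerate, translation invariant, scale covariant with Δ > 0) and every orthogonal
continuum
frame x ≠ 0 ⊥ w, the kernel (s,τ) ↦ K(sx + τw), K(y) = S 2 (0,y), is TP₂ on the quadrant (minors
with
rows 0 < s ≤ t, columns 0 ≤ τ₁ ≤ τ₂). (OLS) ⇒ (OLS)∞ is the provable-now support
OrthantTP2LimitPassage
(one lattice cell in an exactly orthogonal integer frame, read at a finer mesh, converges by locally
uniform convergence + the automatic continuity of the limit; continuum cells chain because K > 0),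
and
(OLS)∞ ⇒ "K is invariant under every linear isometry" is PROVED INLINE in `closes`, continuity-free
(PythagoreanRigidity in sliding-base form: one column-0 minor in the frame based at p(a−η) compares
the
directions p(a), p(a+h) of a great circle and gives cos(η+h)^(2Δ)·K(p(a+h)) ≤ cos(η)^(2Δ)·K(p a); η
→ 0⁺
uses only the continuity of cos; the two-sided bound |log K(p(a+h)) − log K(p a)| ≤ −2Δ log cos h =
o(h) forces zero derivative along every great circle, so K is constant on spheres). (ROT) =
RotationUpgradeFromTwoPoint (item 8367), (C) = ExistsScaleCovariantLimit (1981), (D) =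
InversionUpgradeNormalised (1982), (E) = IsingEuclidUpgradeR4NonGaussian (0636) are the shared tail
of
the isotropy routes (statements verbatim, deduplicated). Isotropy is OUTPUT: (C) carries no rotation
clause. The older supports LimitKernelPythagorean (OLS ⇒ Pythagorean monotonicity K(x+w) ≤ K(x);
complete lean-checked proof attached to stmt-CriticalPhenomena-16806), PythagoreanRigidity and
TwoPointKernelOfLimit (1983, proved on HyperoctahedralRP) remain as dividends / alternative passage.
Lean: `CriticalOrthantTP2 → PythagoreanRigidity → LimitKernelPythagorean → TwoPointKernelOfLimit →
RotationUpgradeFromTwoPoint → ExistsScaleCovariantLimit → InversionUpgradeNormalised →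
IsingEuclidUpgradeR4NonGaussian → Ising3DConformalLimit` (= item Assembly, the eight-item frame,
unchanged). DECIDING THEOREM (rev 5, glue repair 2026-08-16): `closes : LimitOrthantTP2 →
RotationUpgradeFromTwoPoint → ExistsScaleCovariantLimit → InversionUpgradeNormalised →
IsingEuclidUpgradeR4NonGaussian → Ising3DConformalLimit` — CRUX-ONLY binders (the gate's
glue.non-crux-hypothesis lint of rev 3/4 is cleared: the support LimitKernelPythagorean is no longer
a hypothesis), sorry-free, 10 k chars (< 12 k cap), axioms propext/Classical.choice/Quot.sound,
lean-checked in the planner's Sketch.lean; the route file still imports NOTHING outside the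
sub-problem Statement cone (`Literature…ScalingLimit3D` + Mathlib; rev 2 had pulled 28 unproved
named facts in through a Theorems import), so staffability is untouched. CriticalOrthantTP2 (rank 2)
stays the route's own lattice crux and is reached by `closes` through the two-layer edge
OrthantTP2LimitPassage : CriticalOrthantTP2 → LimitOrthantTP2 (support, provable-now); once that
support is landed a tenure edit may rebind `closes` to CriticalOrthantTP2 + the proved support.

## Assembly
Pure logic given the items (item Assembly, unchanged); the deciding theorem `closes` (rev 5) binds
the cruxes LimitOrthantTP2, RotationUpgradeFromTwoPoint, ExistsScaleCovariantLimit,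
InversionUpgradeNormalised, IsingEuclidUpgradeR4NonGaussian only: take (ρ, Δ, S) from
ExistsScaleCovariantLimit; non-degeneracy and scale covariance give positivity and homogeneity
K(c•y) = c^(−2Δ)K(y) of K(y) = S 2 (0,y); LimitOrthantTP2 with (τ₁, τ₂) = (0, 1) gives the column-0
minors K(t x)·K(s x + w) ≤ K(s x)·K(t x + w) (0 < s ≤ t, x ≠ 0 ⊥ w); the inline rigidity lemma (for
any positive K homogeneous of degree −2Δ with these minors): for an orthonormal pair (e,f) put p(θ)
= cos θ e + sin θ f, so ⟪p a, p b⟫ = cos(a−b) and p(b+θ) = cos θ p b + sin θ p(b+π/2); for 0 < h <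
π/2 and small s > 0 set η = s·h, b = a − η and apply the minor in the frame x = p b, w = tan
η·(p(b+η+h)/cos(η+h) − p b) ⊥ p b with (s,t) = (tan η, tan(η+h)): the two composite points are (tan
η/cos(η+h))·p(a+h) and (tan(η+h)/cos η)·p(a) (a trig identity in the basis p b, p(b+π/2)), so
homogeneity and logs give 2Δ log cos(η+h) + log K(p(a+h)) ≤ 2Δ log cos η + log K(p a); s → 0⁺
(le_of_tendsto_of_tendsto, continuity of cos∘affine, log) yields 2Δ log cos h + log K(p(a+h)) ≤ log
K(p a) for 0 < h < π/2, and the mirror pair (e, −f) gives it for −π/2 < h < 0; hence |log K(p(a+h))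
− log K(p a)| ≤ 2Δ|log cos h| = o(h), θ ↦ log K(p θ) has zero derivative everywhere
(is_const_of_deriv_eq_zero) and K f = K e; a unit vector n orthogonal to x and Rx (dimension count
in ℝ³) then gives K(Rx) = ‖x‖^(−2Δ)K(n) = K(x) for every linear isometry R;
RotationUpgradeFromTwoPoint gives IsRotationInvariant S, hence IsEuclideanInvariant S :=
⟨translation, rotation⟩; InversionUpgradeNormalised gives IsInversionCovariant Δ S;
IsMoebiusCovariant Δ S := ⟨Euclid, scale, inversion⟩; IsingEuclidUpgradeR4NonGaussian gives
HasNontrivialU4 S; conclude Ising3DConformalLimit = CritIsing3DConformalLimit with the witness (ρ,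
Δ, S).

Rationale: WHY THIS LINE. ℤ³ cannot state a rotation but it can state a right angle: u·v = 0 over ℤ, and
|au−bv|² = a²|u|²+b²|v|² (Pythagoras). Reading the critical two-point function along a pair of
orthogonal lattice rays gives a kernel K_{u,v}(a,b) = ⟨σ₀σ_{au−bv}⟩ whose 2×2 minors have an exact
random-current face (switching lemma, Aizenman1982, AizenmanDuminilCopinAnnals2021 §2): TP₂ ⟺
mutually avoiding sourced double-current pairs weigh more when paired in parallel than crosswise.
Total positivity is imported from analysis/combinatorics (Karlin1968, Schoenberg1951; planar Ising
boundary TP: Lis2016, GalashinPylyavskyy2020, where planarity forces crossed paths to meet); the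
transplant replaces planarity by lattice orthogonality and is rigid exactly at a scale-covariant
point: frame-wise TP₂ of a homogeneous continuous kernel is EQUIVALENT to rotation invariance
(PythagoreanRigidity), while off criticality it is free (e^{−N(x)} is frame-TP₂ for every smooth
convex norm — Hegerfeldt1977's anisotropic T>T_c profiles pass). What no open route does:
displacement-space order information exists on this problem only across the nine lattice MIRRORS
(MessagerMiracleSoleJSP1977, Hegerfeldt1977; HyperoctahedralRP/MirrorHoelderCompactness use the
mirror RP cone, GaussianScaleMixture complete monotonicity in x², HarmonicMomentsIsotropy moment
identities, TauBallRounding a subcritical norm, VolterraWard surgery): (OLS) is a determinantal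
inequality in NON-mirror frames such as (2,1,0)/(1,−2,0), it is violated by the anisotropic
reflection-positive long-range family of
Literature.Barriers.CriticalPhenomena.LongRangeTrivialityOnZ3 (so it is finite-range information, as
any isotropy input must be), and it is confirmed cell by cell: exactly at 2D T_c (3095 cells, 12
frames, McCoy–Wu/Perk identity), for the ℤ³ lattice GFF (30+ frames; a theorem in
coordinate-disjoint frames by Karlin's TP of birth–death kernels), and by Wolff MC of n.n. ℤ³ Ising
at β_c on L = 96 (22 frames, 497 cells, minimum z = +9.9; card's kit job j000390).

RANKED CRUXES. #2 CriticalOrthantTP2 (crux) — (OLS) at β = β_c(3) (card K1): for all u, v ∈ ℤ³∖0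
with Σᵢuᵢvᵢ = 0 and all a, b ∈ ℕ, G((a+1)u−bv)·G(au−(b+1)v) ≤ G(au−bv)·G((a+1)u−(b+1)v), G =
criticalTwoPoint 3 = ⟨σ₀σ_x⟩⁺ at β_c, h = 0 (unit-cell log-supermodularity; general rectangles
follow since G > 0 by criticalTwoPoint_bounds_holds; the origin cell is Griffiths II). Current face:
with x₁ = au−bv, x₂ = x₁+u the cell says the weighted count of DISJOINT sourced double-current pairs
with sources (0,x₁),(v,x₂) (parallel) is at least that with sources (0,x₂),(v,x₁) (crossed).
Conjectured for all 0 ≤ β ≤ β_c (card P3); only β_c is load-bearing here. [difficulty: open-problem]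
(why it might fail: an exact all-scale inequality can fail at lattice scale in some untested tilted
frame or large (a,b) although 497 MC cells (L=96, z ≥ 9.9), the exact 2D T_c table and the GFF pass;
only its eventual form is forced by isotropy, so a small-cell failure would not even contradict
clause (ii).) [Lis2016, GalashinPylyavskyy2020, MessagerMiracleSoleJSP1977, Hegerfeldt1977,
Aizenman1982, AizenmanDuminilCopinAnnals2021, Karlin1968]
#3 RotationUpgradeFromTwoPoint (crux) — (ROT, shared item 8367, verbatim) every normalised (S = 0
off NonCoincident), non-degenerate, translation-invariant, scale-covariant pointwise scaling limit S
of criticalCorr 3 whose two-point kernel is invariant under all linear isometries is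
IsRotationInvariant (all n, O(3)). The n-point half of isotropy; this route supplies its hypothesis.
[deps: CriticalOrthantTP2] [difficulty: open-problem] (why it might fail: no theorem upgrades
two-point isotropy to n-point O(3) invariance; a B₃- but not O(3)-invariant S₄ with round S₂
violates no known inequality; the planar proof (DKKMO2020Rotational) is star–triangle specific.)
[DuminilCopinICM2022, DKKMO2020Rotational, FrohlichEtAl1978]
#4 ExistsScaleCovariantLimit (crux) — (C, shared item 1981, verbatim) there are ρ > 0 on (0,1], Δ >
0 and S with HasPointwiseScalingLimit (criticalCorr 3) ρ S, S = 0 off NonCoincident,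
IsNondegenerateTwoPoint S, IsTranslationInvariant S, IsScaleCovariant Δ S — existence WITHOUT a
rotation clause (isotropy is output on this route). [difficulty: open-problem] (why it might fail:
full δ→0⁺ convergence with one continuous Δ is open on ℤ³ (DuminilCopinICM2022 §8.4); c|x|⁻² ≤ G ≤
C|x|⁻¹ gives only subsequential limits with Δ ∈ [1/2,1]; log-periodic profiles are not excluded by
RP/GKS.) [DuminilCopinICM2022, DuminilcopinPanis2025, AizenmanDuminilCopinAnnals2021,
DuminilCopin2019]
#5 InversionUpgradeNormalised (crux) — (D, shared item 1982, verbatim) every normalised,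
non-degenerate, Euclidean-invariant, scale-covariant pointwise scaling limit of criticalCorr 3 is
inversion covariant with the same Δ (hence Möbius). [deps: RotationUpgradeFromTwoPoint] [difficulty:
open-problem] (why it might fail: scale + Euclid + RP do not force Möbius (free Maxwell d=3,
ElshowkNakayamaRychkov2011; barrier ScaleCovarianceNotMoebius); the Ising input (no dimension-2
virial current) is known only non-rigorously (DelamotteTissierWschebor2016) and numerically (Δ_V >
5, MenesesEtAl2019).) [ElshowkNakayamaRychkov2011, Nakayama2015, DelamotteTissierWschebor2016,
MenesesEtAl2019, PolandRychkovVichi2019]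
#6 IsingEuclidUpgradeR4NonGaussian (crux) — (E, shared item 0636, verbatim) every non-degenerate
pointwise scaling limit S of the renormalised critical Ising correlators on ℤ³ has U₄ ≢ 0 on
non-coincident configurations (random-current identity U₄ = −2⟨σσ⟩⟨σσ⟩P[the two double-current
clusters intersect]). [difficulty: open-problem] (why it might fail: no proof that the intersection
probability of two double-current clusters at macroscopic separation stays positive as δ→0 in d = 3;
intersection/bubble methods prove only triviality (d ≥ 4, Aizenman1982,
AizenmanDuminilCopinAnnals2021); the window η < 1/2 is needed and open.) [Aizenman1982,
AizenmanDuminilCopinAnnals2021, DuminilCopinICM2022]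
#7 LimitOrthantTP2 (crux) — (OLS)∞, the scaling-limit shadow of (OLS) that the deciding theorem
consumes (rev 5): for every pointwise scaling limit S of criticalCorr 3 (ρ > 0 on (0,1]) that is
non-degenerate, translation invariant and scale covariant with Δ > 0, and all x ≠ 0 ⊥ w in ℝ³, 0 < s
≤ t, 0 ≤ τ₁ ≤ τ₂: K(t x + τ₁ w)·K(s x + τ₂ w) ≤ K(s x + τ₁ w)·K(t x + τ₂ w), K(y) = S 2 (0,y)
(frame-wise TP₂ of the limit kernel on the quadrant, column τ₁ = 0 included; s > 0 keeps every point
off the coincident locus, so no normalisation clause is needed). Implied by CriticalOrthantTP2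
(support OrthantTP2LimitPassage); given K > 0 and homogeneity it is EQUIVALENT to invariance of K
under all linear isometries (⇐: for K = c|y|^(−2Δ), ∂ₛ∂_τ log K = 4Δsτ/(s²+τ²)² ≥ 0; ⇒: the
continuity-free rigidity proved inline in `closes`). Staffing note: provers attack #2 and the
support, not #7 directly; refuters may attack #7 (an admissible anisotropic limit kills every
isotropy route at once). [deps: CriticalOrthantTP2] [difficulty: open-problem] (why it might fail:
it is equivalent to O(3) invariance of the two-point function of every admissible limit, open
(DuminilCopinICM2022 §8.4); a B₃-symmetric but anisotropic homogeneous limit kernel, excluded by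
nothing proved in tree, violates a minor in some tilted frame.) [MessagerMiracleSoleJSP1977,
Hegerfeldt1977, Schoenberg1951, DuminilCopinICM2022]
#9 PythagoreanRigidity (support) — continuum rigidity, minimal form (pure analysis): if K : ℝ³ → ℝ
is positive off 0, homogeneous K(cx) = c^(−2Δ)K(x) (Δ > 0) and Pythagorean-monotone (x ≠ 0, w ⊥ x ⇒
K(x+w) ≤ K(x)), then K(Rx) = K(x) for every linear isometry R and x ≠ 0. Proof: for unit θ, θ' at
angle φ < π/2 take x = θ, w = θ'/cos φ − θ ⊥ θ: K(θ'/cos φ) ≤ K(θ) gives g(θ') ≤ cos(φ)^(−2Δ) g(θ),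
g := K|_(S²); symmetrise and chain along a great circle: |log g(θ₁) − log g(θ₀)| ≤ −2ΔN log cos(Φ/N)
→ 0. Was proved inline by name in revs 2–4; rev 5's `closes` proves instead its SLIDING-BASE variant
from the column-0 TP₂ minors of LimitOrthantTP2 (no exact monotonicity and no continuity of K
needed). The item stays as a dividend an idle prover may land (the rev-4 inline proof is in the
route's git history). [difficulty: provable-now] [Schoenberg1951, Karlin1968, Hegerfeldt1977]
#9 LimitKernelPythagorean (support) — limit passage: CriticalOrthantTP2 ⇒ for every pointwise
scaling limit S of criticalCorr 3 (ρ > 0 on (0,1]) that is non-degenerate, translation invariant and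
scale covariant with Δ, the kernel K(x) = S 2 (0,x) is Pythagorean-monotone: x ≠ 0, ⟪x,w⟫ = 0 ⇒
K(x+w) ≤ K(x). Proof: (i) unit cells multiply to rectangles on the lattice (G > 0,
criticalTwoPoint_bounds_holds); (ii) along δ = 1/N with a_N = ⌊sN/‖u‖⌋, b_N = ⌊tN/‖v‖⌋ the lattice
points a_N u − b_N v are exact lattice approximations of x_N → sû − tv̂, and local uniform
convergence + continuity of K off 0 (twoPointKernelOfLimit_proof) give TP₂ of k(s,t) = K(sû − tv̂)
on the real quadrant for every lattice-orthogonal frame; (iii) TP₂ ⇒ k(s,t')/k(s,t) is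
non-decreasing in s and tends to 1 as s → ∞ (homogeneity with c = s and continuity at û), hence ≤ 1:
K(sû − tv̂) ≤ K(sû); (iv) lattice-orthogonal frames (u/‖u‖, v/‖v‖) are dense among orthonormal pairs
(integer directions are dense in S²; ℤ³ ∩ u^⊥ ⊇ span(u×e₁,u×e₂,u×e₃) has rank 2 and dense directions
in the circle u^⊥ ∩ S²), and the inequality is closed under limits by continuity of K at x and x+w ≠
0. No longer a hypothesis of `closes` (rev 5; it was the non-crux binder flagged at rev 3/4). A
COMPLETE lean-checked proof (rc 0, 0 sorries, standard axioms at rev 3: density realised by the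
exactly orthogonal integer frames ([x/δ], B·[x/δ] − A·[w/δ]) at mesh δ/A; continuity of S 2 from
translation invariance by the cellmate-shift pigeonhole; lattice positivity replaced by the eventual
positivity of the chained values read off the limit) is attached to item
stmt-CriticalPhenomena-16806 as a ready-to-land Theorems file; it also contains steps (i)–(ii) of
OrthantTP2LimitPassage for the column τ₁ = 0. [difficulty: provable-now]
[MessagerMiracleSoleJSP1977, DuminilCopin2019, AizenmanDuminilCopinAnnals2021]
#9 TwoPointKernelOfLimit (support) — (shared item 1983, verbatim; PROVED in tree by
HyperoctahedralRPTwoPoint.twoPointKernelOfLimit_proof) for every non-degenerate,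
translation-invariant, scale-covariant pointwise scaling limit S of criticalCorr 3 the kernel K x :=
S 2 (0,x) has 1/2 ≤ Δ ≤ 1, ContinuousOn K {0}ᶜ, K > 0 off 0, K(c•x) = c^(−2Δ) K x, invariance and
reflection positivity in the nine lattice mirrors. This route uses the first four clauses.
[difficulty: provable-now] [MessagerMiracleSoleJSP1977, FrohlichEtAl1978, DuminilcopinPanis2025]
#9 OrthantTP2LimitPassage (support) — the two-layer edge CriticalOrthantTP2 → LimitOrthantTP2 (rev
5), provable now: (i) one lattice cell (a,b) of CriticalOrthantTP2 in the exactly orthogonal integer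
frame u = A·[y/δ], v = A·[w′/δ] − B·[y/δ] (A = |[y/δ]|², B = ⟨[y/δ],[w′/δ]⟩, so Σuᵢvᵢ = 0 over ℤ; u,
v ≠ 0 for small δ since (δ/A)·u → y ≠ 0 and (δ/A)·v → w′, the case w′ = 0 being trivial), read at
mesh ε = δ/A where ε·p is an exact lattice configuration (latticeApprox ε (ε•p) = p, first point 0),
converges as δ → 0⁺ — locally uniform convergence of rescaledCorrelator (criticalCorr 3) ρ 2 near
(0, target) plus continuity of S 2 off the diagonal, which is AUTOMATIC for every pointwise limit
(tree, importable: RotationUpgradeFromTwoPointNegative.limit_continuousOn / continuousOn_of_limit in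
Theorems/RotationUpgradeFromTwoPoint/Negative/ContinuityFree.lean, cellmate-shift pigeonhole; or
re-derived from IsTranslationInvariant S as in the 16806 evidence file) — to the unit continuum cell
K((a+1)y + b w′)·K(a y + (b+1)w′) ≤ K(a y + b w′)·K((a+1)y + (b+1)w′) for all real y ≠ 0 ⊥ w′, a ≥
1, b ≥ 0; (ii) continuum cells multiply to rectangles because K > 0 off 0 (IsNondegenerateTwoPoint),
which with y = x/N, w′ = w/M gives every rational 0 < s ≤ t, 0 ≤ τ₁ ≤ τ₂; (iii) real parameters by
continuity of K. A Theorems file importing only the route file and ContinuityFree keeps the cone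
inside already-landed modules. [difficulty: provable-now] [MessagerMiracleSoleJSP1977,
DuminilCopin2019, AizenmanDuminilCopinAnnals2021]

TWO-LAYER PLAN. Realised at rev 5: LimitOrthantTP2 ⇐ CriticalOrthantTP2 through the glue support
OrthantTP2LimitPassage (the deciding theorem binds the parent; the lattice crux is the child that
provers attack). Foreseen glued splits once a node moves: CriticalOrthantTP2 ⇐ RayCellsTP2 (b = 0
cells: G(au)G((a+1)u−v) ≥ G((a+1)u)G(au−v), the ratio G(au−v)/G(au) ↑ in a — a one-sided Harnack
monotonicity along rays) → InteriorCellsTP2 → CriticalOrthantTP2; or by frame class: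
CoordinateDisjointFrames (supp u ∩ supp v = ∅, where the GFF corner is a theorem and the current
surgery is mirror-assisted) → TiltedFrames → CriticalOrthantTP2 (k ≤ 3, depth 1).
RotationUpgradeFromTwoPoint ⇐ OS-continuation in the nine time directions + round S₂ → B₃-to-O(3) →
8367 (shared with HyperoctahedralRP/GaussianScaleMixture).

KILL CRITERIA. A significant MC violation of one TP₂ cell at β_c(3) (3σ, with L(|x|+1) ≲ L_box/8) or
an exact violation in the leading high-temperature orders propagating to β_c refutes
CriticalOrthantTP2; since rev 5 `closes` survives formally on LimitOrthantTP2, but the route's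
lattice ENGINE is then gone: unless the violated cell is a small-scale one and an
eventual/asymptotic lattice version (cells beyond R₀(u,v)) is filed as the repaired child within the
grace window, close `refuted:CriticalOrthantTP2` (the card is closed falsified; the rigidity/limit
supports survive as lemmas). A refutation of LimitOrthantTP2 itself (an admissible limit with an
anisotropic two-point kernel) refutes clause (ii) for that limit and breaks every two-point isotropy
route at once. A refutation of RotationUpgradeFromTwoPoint (a B₃-invariant non-isotropic admissible
S₄ over a round S₂ realised by an Ising-type limit) breaks every two-point isotropy route at once —
pivot to n-point order statements (crossed-vs-parallel merging for 2n sources) or retire.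
ExistsScaleCovariantLimit / InversionUpgradeNormalised / IsingEuclidUpgradeR4NonGaussian refuted ⇒
the conjunct itself is in doubt (CanonicalBranchRefutation territory). Isotropy of the two-point
limit proved elsewhere (HyperoctahedralRP, GaussianScaleMixture, VolterraWard, TauBallRounding,
HarmonicMomentsIsotropy) moots the route's own crux but not its dividends.

NOT DECOMPOSED YET. The random-current form of a cell (parallel-vs-crossed disjoint pairings) is not
filed as an item: it is an exact finite-graph identity (switching lemma) and belongs to the prover's
file with `--supports CriticalOrthantTP2`; the all-β version (0 ≤ β ≤ β_c) and the lattice-GFF frame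
theorem (card P3/P2) are dividends, not load-bearing; the exactly-orthogonal integer frames, the
cell-to-rectangle multiplication and the rational-to-real passage sit inside the support
OrthantTP2LimitPassage (no third layer); constants R₀(u,v) of an eventual version are not introduced
(the all-scale form is the conjecture; only its scaling-limit shadow is consumed).

CHEAPEST FALSIFIER. Already run by the card's author (kit j000390; folder mc/RESULTS-L96.md of
planner-mechhunt-2271-4): Wolff MC of n.n. ℤ³ Ising at β_c = 0.2216546, L = 96, 214 400 measurements
— all 497 TP₂ cells in 22 lattice-orthogonal frames are ≥ 1 with minimum z = +9.9, near-ray cells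
reproduce the continuum margins to 10⁻⁴; exact 2D T_c table (3095 cells, 12 frames, margins down to
1.00002) and the ℤ³ lattice GFF (30+ frames to |x| ≤ 16, 14 frames to |x| ≤ 40) without a violation;
subcritical/1D controls of plain Euclidean monotonicity fail as they must. Cheapest remaining kill:
a frame not among the 22 at distances 12–30 with improved estimators, or the exact order-t¹⁰
high-temperature coefficients of one tilted cell. Not re-run in this session (no new information
expected below L = 128).

NUMBERS. Δ_σ = 0.5181489(10), η = 0.036298(2) (bootstrap, PolandRychkovVichi2019); ω ≈ 0.83, cubic
(ℓ = 4) anisotropy exponent ω₄ ≈ 2.02 (CampostriniEtAl1998, Hasenbusch2021) — the TP₂ log-margin of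
a unit cell at radius r is 4Δab|u|²|v|²/r⁴ ~ Δ/r², above every correction order (r^(−2−ω),
r^(−4.02)) except through a non-constant angular profile, which enters at the margin's own order
(PythagoreanRigidity). Known at β_c(3): c‖x‖⁻² ≤ G ≤ C‖x‖⁻¹ (DuminilCopin2019 Thm 4.8, in tree),
hence Δ ∈ [1/2, 1]; MC β_c = 0.221654626(5). Items: 9 at open (1 own crux, 4 shared cruxes, 3
supports, 1 assembly); 11 after rev 5 (+ crux LimitOrthantTP2 r7, + support OrthantTP2LimitPassage).
Rev 3 (cone repair 2026-08-16): the route file imports nothing outside the Statement cone (module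
cone 45 files, 0 unproved named facts; was 170 / 28). Rev 5 (glue repair 2026-08-16): `closes` binds
the five cruxes LimitOrthantTP2, ROT, C, D, E only (10.1 k chars < 12 k glue cap; axioms
propext/Classical.choice/Quot.sound), no import added.

DEFINITION REQUESTS. None: Site, criticalTwoPoint, criticalCorr, CorrFamily,
HasPointwiseScalingLimit, NonCoincident, IsNondegenerateTwoPoint, IsTranslationInvariant,
IsRotationInvariant, IsEuclideanInvariant, IsScaleCovariant, IsInversionCovariant, HasNontrivialU4
exist (all elaborated in Sketch.lean, rc 0). Optional later: `doubleCurrentDisjointPairing` for the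
current face (prover's helper, not an item).

Novelty: Searches (2026-08-16): `lit search --source zbmath` "total positivity two-point function Ising" (0),
"log-supermodular correlation function lattice" (2, unrelated: q-FKG, Fréchet bounds), "planar Ising
boundary correlations totally positive Lis" (1: GalashinPylyavskyy2020), "monotonicity Ising
correlations reflection Hegerfeldt" (0), "rotational invariance critical Ising model three
dimensions" (1: BBS RG lecture notes); `lit search --source arxiv` "total positivity Ising
correlations" (Lis2016, GalashinPylyavskyy2020, Lis 2020 Ashkin–Teller boundary; rest unrelated);
`lit galaxy search --star all` "two-point function is totally positive" (0), "Messager Miracle-Sole"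
(0), `--star pdf` "log-supermodular" (8, economics/graph homomorphisms, none stat-mech); `lit
frontier CriticalPhenomena --since 2021` (30 rows; nearest: arXiv:2603.16318 Wulff crystal of planar
self-dual FK rounds near criticality — planar, subcritical-norm class of TauBallRounding); `lit read
arXiv:1511.05524` (Lupu–Werner, for a discarded loop-soup lever); grep of all 50 Theses files for
supermodular/TP2/total positivity/orthogonal frames (no route uses the lever; 'supermodular' occurs
only as GKS-II/ghteSum supermodularity in FKParityRobustness, MoebiusRestrictionCurrents,
SubPtolemyInterlacing); the card's own 2026-08-15 crossref/zbMATH/galaxy log (11 + 5 queries, 0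
relevant) and the mechanism critic's openalex query (2, irrelevant).
Nearest prior art found: Lis2016 (doi:10.1007/s10955-016-1690-x; total nonn  [refs: 10.1007/s10955-016-1690-x, 2603.16318, 1511.05524, doi:10.1007/s10955-016-1690-x, GalashinPylyavskyy2020, Lis2016, MessagerMiracleSoleJSP1977, Hegerfeldt1977, Karlin1968, Schoenberg1951]

Barriers (technique_class: total-positivity, correlation-inequality, switching-lemma): - technique_class: total-positivity, correlation-inequality, switching-lemma
- Literature.Barriers.CriticalPhenomena.LongRangeTrivialityOnZ3: its contrary reflection-positive
ℓ¹-tailed long-range models keep GKS/GHS/Lebowitz/MMS/RP yet have ANISOTROPIC scale-invariant limits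
(IsotropyAudit G1); by PythagoreanRigidity they violate asymptotic (OLS), so (OLS) is not in the
interaction-uniform inequality cone the audit says cannot give isotropy — it is finite-range
information, and any proof must use the n.n. structure (the current face does).
- Literature.Barriers.CriticalPhenomena.ScaleCovarianceNotMoebius: not engaged by the route's own
crux (rotations at n = 2 only, its witnesses are isotropic); engaged by the shared item
InversionUpgradeNormalised exactly as on GaussianScaleMixture/HyperoctahedralRP — it does not evade
it; the bet there is Ising-specific input (vector gap), staffed once for all isotropy routes.
- Literature.Barriers.CriticalPhenomena.LayeredTrivialityOnZ3: not engaged by the route's own crux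
(an isotropy input for clause (ii)); clause (iii) is the shared item
IsingEuclidUpgradeR4NonGaussian, whose proof must use an input failing for decoupled critical planes
(irreducibility / MMS across axes), as on every isotropy route; for the record the route's own chain
is not vertically uniform either — for `crossoverCoupling 0` the two-point function vanishes
off-plane, so the non-degeneracy and K > 0 consumed by PythagoreanRigidity fail, and (OLS)
degenerates to 0 ≤ 0

History (route lifecycle, newest last):
- 2026-08-16T20:54:10Z · rev 1: restated PythagoreanRigidity (stmt-CriticalPhenomena-16805) — restate PythagoreanRigidity without the (unneeded) continuity hypothesis; closes no longer assumes TwoPointKernelOfLimit/Assembly (positivity and homogeneity of (planner-plan-novel-CriticalPhenomena-Ising3DCon-3ad144fc-v2-)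
- 2026-08-25T05:26:42Z · DORMANT — reconciler: no traction for 7.4 d (last activity item-evidence-added at 2026-08-17T19:01:55Z); parked, not closed — `ledger route dormant route-CriticalPhenomen (operator:999:1930717)
- 2026-08-27T13:29:54Z · REACTIVATED — reconciler: reactivated — activity statement-claimed at 2026-08-27T11:07:20Z after parking at 2026-08-25T05:26:42Z (operator:999:2734868)
- 2026-08-29T19:32:58Z · DORMANT — census g0: costume|duplicate of route-CriticalPhenomena-HyperoctahedralRP; reader census-reader-36-g0 (operator:999:1209955)

sub-problem: Ising3DConformalLimit · status: dormant · opened planner-plan-novel-CriticalPhenomena-Ising3DCon-3ad144fc-v2-g8-0 2026-08-16T20:51:31Z · rev 6 · ledger route-CriticalPhenomena-OrthogonalFrameTP2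
GENERATED by the gate from the ledger (D-0016/17). Provers cite these decls: `theorem foo : Summit.CriticalPhenomena.Ising3DConformalLimit.Theses.OrthogonalFrameTP2.<Decl> := …` in Summits/CriticalPhenomena/Ising3DConformalLimit/Theorems/<Name>.lean.
-/

namespace Summit.CriticalPhenomena.Ising3DConformalLimit.Theses.OrthogonalFrameTP2

open scoped BigOperators Topology Manifold Classical MeasureTheory ProbabilityTheory Matrix InnerProductSpace ComplexConjugate ContinuousMap
open Filter Set Function TopologicalSpace MeasureTheory

attribute [summit_statement] _root_.Ising3DConformalLimit

/-- item stmt-CriticalPhenomena-16804 · crux · rank 2 · open · by planner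
why it might fail: an exact all-scale inequality can fail at lattice scale in some untested tilted frame or large (a,b) although 497 MC cells (L=96, z ≥ 9.9), the exact 2D T_c table and the GFF pass; only its eventual form is forced by isotropy, so a small-cell failure would not even contradict clause (ii).
sources: Lis2016, GalashinPylyavskyy2020, MessagerMiracleSoleJSP1977, Hegerfeldt1977, Aizenman1982, AizenmanDuminilCopinAnnals2021
[crux] (OLS) at β = β_c(3) (card K1): for all u, v ∈ ℤ³∖0 with Σᵢuᵢvᵢ = 0 and all a, b ∈ ℕ,
G((a+1)u−bv)·G(au−(b+1)v) ≤ G(au−bv)·G((a+1)u−(b+1)v), G = criticalTwoPoint 3 = ⟨σ₀σ_x⟩⁺ at β_c, h =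
0 (unit-cell log-supermodularity; general rectangles follow since G > 0 by
criticalTwoPoint_bounds_holds; the origin cell is Griffiths II). Current face: with x₁ = au−bv, x₂ =
x₁+u the cell says the weighted count of DISJOINT sourced double-current pairs with sources
(0,x₁),(v,x₂) (parallel) is at least that with sources (0,x₂),(v,x₁) (crossed). Conjectured for all
0 ≤ β ≤ β_c (card P3); only β_c is load-bearing here. [difficulty: open-problem] -/
@[route_item "route-CriticalPhenomena-OrthogonalFrameTP2"]
def CriticalOrthantTP2 : Prop :=
  ∀ (u v : Literature.Probability.LatticeModels.Site 3), u ≠ 0 → v ≠ 0 → (∑ i, u i * v i = 0) → ∀ a b : ℕ, Literature.Probability.LatticeModels.criticalTwoPoint 3 (fun i => ((a : ℤ) + 1) * u i - (b : ℤ) * v i) * Literature.Probability.LatticeModels.criticalTwoPoint 3 (fun i => (a : ℤ) * u i - ((b : ℤ) + 1) * v i) ≤ Literature.Probability.LatticeModels.criticalTwoPoint 3 (fun i => (a : ℤ) * u i - (b : ℤ) * v i) * Literature.Probability.LatticeModels.criticalTwoPoint 3 (fun i => ((a : ℤ) + 1) * u i - ((b : ℤ) + 1) * v i)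

/-- item stmt-CriticalPhenomena-8367 · crux · rank 3 · closed · proved by Summit.CriticalPhenomena.Ising3DConformalLimit.Cruxes.RotationUpgradeFromTwoPoint.NullLaplacianEdgeGaussianity.RotationUpgradeFromTwoPoint_of @ 5ed22cfef2ac (prover) · by planner
why it might fail: no theorem upgrades two-point isotropy to n-point O(3) invariance; a B₃- but not O(3)-invariant S₄ with round S₂ violates no known inequality; the planar proof (DKKMO2020Rotational) is star–triangle specific.
sources: DuminilCopinICM2022, DKKMO2020Rotational, FrohlichEtAl1978
[crux] every normalised (S = 0 off NonCoincident), non-degenerate, translation-invariant,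
scale-covariant pointwise scaling limit S of criticalCorr 3 (ρ > 0 on (0,1]) whose two-point kernel
x ↦ S 2 (0,x) is invariant under all linear isometries (x ≠ 0) is IsRotationInvariant (all n, O(3)
incl. reflections). The n-point half of the isotropy problem, stated so that HyperoctahedralRP can
consume it too (HRP2Rigidity ∘ TwoPointKernelOfLimit gives the hypothesis); intended engines: OS
continuation of S_n in the nine lattice time directions + B₃ + round S₂, or boost/modular
covariance. [difficulty: open-problem] -/
@[route_item "route-CriticalPhenomena-OrthogonalFrameTP2", crux]
def RotationUpgradeFromTwoPoint : Prop :=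
  ∀ (ρ : ℝ → ℝ) (Δ : ℝ) (S : Literature.Probability.LatticeModels.CorrFamily 3), (∀ δ ∈ Set.Ioc (0:ℝ) 1, 0 < ρ δ) → Literature.Probability.LatticeModels.HasPointwiseScalingLimit (Literature.Probability.LatticeModels.criticalCorr 3) ρ S → (∀ n z, z ∉ Literature.Probability.LatticeModels.NonCoincident 3 n → S n z = 0) → Literature.Probability.LatticeModels.IsNondegenerateTwoPoint S → Literature.Probability.LatticeModels.IsTranslationInvariant S → Literature.Probability.LatticeModels.IsScaleCovariant Δ S → (∀ (R : EuclideanSpace ℝ (Fin 3) ≃ₗᵢ[ℝ] EuclideanSpace ℝ (Fin 3)) (x : EuclideanSpace ℝ (Fin 3)), x ≠ 0 → S 2 ![0, R x] = S 2 ![0, x]) → Literature.Probability.LatticeModels.IsRotationInvariant S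

/-- `RotationUpgradeFromTwoPoint` holds: proved by `Summit.CriticalPhenomena.Ising3DConformalLimit.Cruxes.RotationUpgradeFromTwoPoint.NullLaplacianEdgeGaussianity.RotationUpgradeFromTwoPoint_of` @ 5ed22cfef2ac. -/
theorem RotationUpgradeFromTwoPoint_holds : RotationUpgradeFromTwoPoint := _root_.Summit.CriticalPhenomena.Ising3DConformalLimit.Cruxes.RotationUpgradeFromTwoPoint.NullLaplacianEdgeGaussianity.RotationUpgradeFromTwoPoint_of

/-- item stmt-CriticalPhenomena-1981 · crux · rank 4 · SPLIT (gen 1) into TwoPointDoubling, ClusterSetTotallyDisconnected + glue Summit.CriticalPhenomena.Ising3DConformalLimit.Cruxes.ExistsScaleCovariantLimit.PositivityBegetsConformalityMaps.crux_of_doubling_of_totallyDisconnected · direct attempts still welcome (low priority) · by planner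
why it might fail: full δ→0⁺ convergence with one continuous Δ is open on ℤ³ (DuminilCopinICM2022 §8.4); c|x|⁻² ≤ G ≤ C|x|⁻¹ gives only subsequential limits with Δ ∈ [1/2,1]; log-periodic profiles are not excluded by RP/GKS.
sources: DuminilCopinICM2022, DuminilcopinPanis2025, AizenmanDuminilCopinAnnals2021, DuminilCopin2019
[crux r4, (C), existence WITHOUT rotations] There are ρ > 0 on (0,1], Δ > 0 and S with
HasPointwiseScalingLimit (criticalCorr 3) ρ S, S = 0 off NonCoincident, IsNondegenerateTwoPoint S,
IsTranslationInvariant S, IsScaleCovariant Δ S. Strictly weaker than CritIsing3DEuclideanLimit (item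
0638: rotations included) — on this route isotropy is OUTPUT. Inputs in tree:
criticalTwoPoint_bounds_holds (c|x|⁻² ≤ G ≤ C|x|⁻¹ ⇒ subsequential limits, Δ ∈ [1/2,1]); missing:
uniqueness/full-filter convergence and continuous scale covariance (DuminilCopinICM2022 §8.4 p.29:
'widely open'). -/
@[route_item "route-CriticalPhenomena-OrthogonalFrameTP2", crux]
def ExistsScaleCovariantLimit : Prop :=
  ∃ (ρ : ℝ → ℝ) (Δ : ℝ) (S : Literature.Probability.LatticeModels.CorrFamily 3), (∀ δ ∈ Set.Ioc (0:ℝ) 1, 0 < ρ δ) ∧ 0 < Δ ∧ Literature.Probability.LatticeModels.HasPointwiseScalingLimit (Literature.Probability.LatticeModels.criticalCorr 3) ρ S ∧ (∀ n z, z ∉ Literature.Probability.LatticeModels.NonCoincident 3 n → S n z = 0) ∧ Literature.Probability.LatticeModels.IsNondegenerateTwoPoint S ∧ Literature.Probability.LatticeModels.IsTranslationInvariant S ∧ Literature.Probability.LatticeModels.IsScaleCovariant Δ S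

/-- item stmt-CriticalPhenomena-1982 · crux · rank 5 · open · by planner
why it might fail: scale + Euclid + RP do not force Möbius (free Maxwell d=3, ElshowkNakayamaRychkov2011; barrier ScaleCovarianceNotMoebius); the Ising input (no dimension-2 virial current) is known only non-rigorously (DelamotteTissierWschebor2016) and numerically (Δ_V > 5, MenesesEtAl2019).
sources: ElshowkNakayamaRychkov2011, Nakayama2015, DelamotteTissierWschebor2016, MenesesEtAl2019, PolandRychkovVichi2019
[crux r5, (D), inversion upgrade re-typed] Every pointwise scaling limit S of criticalCorr 3 (ρ > 0
on (0,1]) that is normalised (S = 0 off NonCoincident), non-degenerate, Euclidean invariant and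
scale covariant with Δ is IsInversionCovariant Δ (hence Möbius). This is (U) of route
IsingEuclidUpgrade (item 0637, refuted AS TYPED by not_inversionUpgrade_of_euclideanLimit through
values on the coincident locus) with the normalisation hypothesis the refutation file prescribes;
the model-blind version is false (Literature.Barriers.CriticalPhenomena.ScaleCovarianceNotMoebius;
free Maxwell d=3, ElshowkNakayamaRychkov2011), so any proof must use the Ising hypothesis (RP +
locality / absence of a dimension-2 virial current: DelamotteTissierWschebor2016 §5–6,
Nakayama2015). -/
@[route_item "route-CriticalPhenomena-OrthogonalFrameTP2", crux]
def InversionUpgradeNormalised : Prop :=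
  ∀ (ρ : ℝ → ℝ) (Δ : ℝ) (S : Literature.Probability.LatticeModels.CorrFamily 3), (∀ δ ∈ Set.Ioc (0:ℝ) 1, 0 < ρ δ) → Literature.Probability.LatticeModels.HasPointwiseScalingLimit (Literature.Probability.LatticeModels.criticalCorr 3) ρ S → (∀ n z, z ∉ Literature.Probability.LatticeModels.NonCoincident 3 n → S n z = 0) → Literature.Probability.LatticeModels.IsNondegenerateTwoPoint S → Literature.Probability.LatticeModels.IsEuclideanInvariant S → Literature.Probability.LatticeModels.IsScaleCovariant Δ S → Literature.Probability.LatticeModels.IsInversionCovariant Δ S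

/-- item stmt-CriticalPhenomena-0636 · crux · rank 6 · SPLIT (gen 1) into TwoPointPowerLawEta, GaussianLimitIsFree + glue IsingEuclidUpgradeR4NonGaussianGlue · direct attempts still welcome (low priority) · by planner
why it might fail: no proof that the intersection probability of two double-current clusters at macroscopic separation stays positive as δ→0 in d = 3; intersection/bubble methods prove only triviality (d ≥ 4, Aizenman1982, AizenmanDuminilCopinAnnals2021); the window η < 1/2 is needed and open.
sources: Aizenman1982, AizenmanDuminilCopinAnnals2021, DuminilCopinICM2022
Crux r4 (non-triviality in d=3): every non-degenerate pointwise scaling limit S of the renormalised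
critical Ising correlators on Z^3 has connected four-point function U4 ≢ 0 on non-coincident
configurations. Intended tool: the random-current identity U4(x,y,z,t) =
−2⟨σxσy⟩⟨σzσt⟩·P^{xy,zt}[C_{n1+n2}(x) ∩ C_{n1+n2}(z) ≠ ∅] (Aizenman 1982; ADC2021 arXiv:1912.07973
eq. (3.11)): non-Gaussianity ⇔ the intersection probability of the two double-current clusters at
macroscopic separation does not vanish as δ → 0. Contrast: for d ≥ 4 every such limit IS Gaussian
(Literature.Probability.LatticeModels.highDim_triviality). Its negation refutes the conjunct
Ising3DConformalLimit itself. -/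
@[route_item "route-CriticalPhenomena-OrthogonalFrameTP2", crux]
def IsingEuclidUpgradeR4NonGaussian : Prop :=
  ∀ (ρ : ℝ → ℝ) (S : Literature.Probability.LatticeModels.CorrFamily 3), (∀ δ ∈ Set.Ioc (0:ℝ) 1, 0 < ρ δ) → Literature.Probability.LatticeModels.HasPointwiseScalingLimit (Literature.Probability.LatticeModels.criticalCorr 3) ρ S → Literature.Probability.LatticeModels.IsNondegenerateTwoPoint S → Literature.Probability.LatticeModels.HasNontrivialU4 S

-- parent: IsingEuclidUpgradeR4NonGaussian · child (gen 1)
/--     item stmt-CriticalPhenomena-5354 · crux · rank 601 · open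
    parent: IsingEuclidUpgradeR4NonGaussian · by planner
    why it might fail: Δ = 1/2 (η_log = 0: canonical Coulomb-with-logs exponent, item 15521's branch) is allowed by every rigorous bound (IR bound + DCP25 Thm 1.5 give only 0 ≤ η ≤ 1/2); no lattice tool gains a power, or even excludes slowly varying saturation, of the IR bound at β_c; numerics η = 0.0363.
    sources: DuminilCopinPanis2025LowerBounds Thm 1.5 (arXiv:2404.05700), KosPolandSimmonsDuffinVichi2016, Hasenbusch2010, FrohlichSimonSpencer1976, DuminilCopinICM2022 §8.4, Literature.Probability.LatticeModels.criticalTwoPoint_bounds_holds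
[crux] (2PT) = card (P2) (item 0634 + strict η > 0, continuum form): every non-degenerate pointwise
scaling limit S of criticalCorr 3 (ρ > 0 on (0,1]) has two-point function S 2 (a,b) = c‖a−b‖^(−2Δ)
for some c > 0 and Δ > 1/2 — isotropy, pure power law and η = 2Δ−1 > 0 at the two-point level.
Rigorously Δ ∈ [1/2,1] for any scale-covariant non-degenerate limit (scalingDimension_mem_Icc_holds)
and η ≤ 1/2 if it exists (DuminilcopinPanis2025 Thm 1.5); the route needs the strict inequality (its
rates are ‖z‖^(1−2Δ)). [difficulty: open-problem] -/
@[route_item "route-CriticalPhenomena-OrthogonalFrameTP2"]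
def TwoPointPowerLawEta : Prop :=
  ∀ (ρ : ℝ → ℝ) (S : Literature.Probability.LatticeModels.CorrFamily 3), (∀ δ ∈ Set.Ioc (0:ℝ) 1, 0 < ρ δ) → Literature.Probability.LatticeModels.HasPointwiseScalingLimit (Literature.Probability.LatticeModels.criticalCorr 3) ρ S → Literature.Probability.LatticeModels.IsNondegenerateTwoPoint S → ∃ c Δ : ℝ, 0 < c ∧ 1 / 2 < Δ ∧ ∀ a b : EuclideanSpace ℝ (Fin 3), a ≠ b → S 2 ![a, b] = c * ‖a - b‖ ^ (-(2 * Δ))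

-- parent: IsingEuclidUpgradeR4NonGaussian · child (gen 1)
/--     item stmt-CriticalPhenomena-2601 · crux · rank 602 · open
    parent: IsingEuclidUpgradeR4NonGaussian · by planner
    why it might fail: False iff the n.n. ℤ³ critical limit is a generalised free field with Δ ∈ (1/2,3/4] — OS-admissible, Möbius covariant, and REALISED by RP long-range α<3/2 models on ℤ³ (Panis2023 Thm 1.2): the proof must use finite range; the germ-Markov-inheritance step has no precedent.
    sources: Newman1975, Pitt1971, Kotani1973, Rozanov1982, Dobrushin1979, Panis2023Triviality Thm 1.2
[crux] (MR)+(MI)+Newman of the card, fused into one typeable statement: for every renormalisation ρ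
> 0 on (0,1], Δ and S, if S is a pointwise scaling limit of criticalCorr 3 with non-degenerate
two-point function, translation invariant and scale covariant with dimension Δ, and U₄(S) ≡ 0 on
non-coincident configurations, then Δ = 1/2. Route of proof: U₄ ≡ 0 ⇒ smeared limit field Gaussian
(Newman 1975, Lee–Yang class; uniform integrability near diagonals from the all-scales limit + scale
covariance); n.n. Gibbs state Markov ⇒ limit germ-Markov (NEW: Markov inheritance); Pitt/Kotani Thm
2/Rozanov: spectral density 1/P, P entire of minimal exponential type, homogeneous of degree 3−2Δ ⇒
P quadratic form ⇒ Δ = 1/2 (Δ = 3/2 white noise excluded by non-degeneracy; window Δ∈[1/2,1] proved: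
scalingDimension_mem_Icc_holds). [difficulty: XL] -/
@[route_item "route-CriticalPhenomena-OrthogonalFrameTP2"]
def GaussianLimitIsFree : Prop :=
  ∀ (ρ : ℝ → ℝ) (Δ : ℝ) (S : Literature.Probability.LatticeModels.CorrFamily 3), (∀ δ ∈ Set.Ioc (0:ℝ) 1, 0 < ρ δ) → Literature.Probability.LatticeModels.HasPointwiseScalingLimit (Literature.Probability.LatticeModels.criticalCorr 3) ρ S → Literature.Probability.LatticeModels.IsNondegenerateTwoPoint S → Literature.Probability.LatticeModels.IsTranslationInvariant S → Literature.Probability.LatticeModels.IsScaleCovariant Δ S → ¬ Literature.Probability.LatticeModels.HasNontrivialU4 S → Δ = 1 / 2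

-- parent: IsingEuclidUpgradeR4NonGaussian · glue (gen 1)
/--     item stmt-CriticalPhenomena-18017 · support · rank 603 · open
    parent: IsingEuclidUpgradeR4NonGaussian · GLUE: children ⟹ parent · by operator
GLUE (provable now, M-minus): TwoPointPowerLawEta → GaussianLimitIsFree →
IsingEuclidUpgradeR4NonGaussian. Proof = 15 lines over landed lemmas (normalise S off NonCoincident:
MoebiusLimitExistsNegative.normalised_hasLimit/_nondeg, isTranslationInvariant_normalised_of_limit,
exists_scaleCovariant_normalised, hasNontrivialU4_normalised_iff; child 1 via
twoPointPowerLawEta_iff_half_lt_delta gives 1/2 < Δ; ¬U₄ + child 2 gives Δ = 1/2). VERBATIM in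
item-0636 evidence IsingEuclidUpgradeR4NonGaussianEtaFreeSplit.lean (theorem
EtaFreeSplit.IsingEuclidUpgradeR4NonGaussian_of_subs_orthogonalFrameTP2; lean check rc0, 0 sorries,
axioms propext/Classical.choice/Quot.sound) — any prover lands that file as
Theorems/IsingEuclidUpgradeR4NonGaussianEtaFreeSplit.lean --workitem <this glue item>. The converse
(parent ⇒ both children) is also kernel-checked there (IsingEuclidUpgradeR4NonGaussian_iff_subs):
the split is an EXACT factorisation. -/
@[route_item "route-CriticalPhenomena-OrthogonalFrameTP2"]
def IsingEuclidUpgradeR4NonGaussianGlue : Prop :=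
  TwoPointPowerLawEta → GaussianLimitIsFree → IsingEuclidUpgradeR4NonGaussian

/-- item stmt-CriticalPhenomena-17189 · crux · rank 7 · open · by planner
why it might fail: equivalent to O(3) invariance of the two-point function of every admissible limit, open (DuminilCopinICM2022 §8.4); a B₃-symmetric but anisotropic homogeneous limit kernel, excluded by nothing proved in tree, violates a minor in some tilted frame; only the column τ₁=0 is probed by the MC cells.
sources: MessagerMiracleSoleJSP1977, Hegerfeldt1977, Schoenberg1951, DuminilCopinICM2022
[crux r7, (OLS)∞ — the scaling-limit shadow of CriticalOrthantTP2 that the deciding theorem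
consumes] For every pointwise scaling limit S of criticalCorr 3 (ρ > 0 on (0,1]) that is
non-degenerate, translation invariant and scale covariant with Δ > 0, and every orthogonal continuum
frame x ≠ 0 ⊥ w, the kernel (s,τ) ↦ K(s x + τ w), K(y) = S 2 (0,y), is TP₂ on the quadrant for the
minors with rows 0 < s ≤ t and columns 0 ≤ τ₁ ≤ τ₂: K(t x + τ₁ w)·K(s x + τ₂ w) ≤ K(s x + τ₁ w)·K(t
x + τ₂ w) (s > 0 keeps every point off the coincident locus). Implied by CriticalOrthantTP2 through
the support OrthantTP2LimitPassage; given positivity and homogeneity it is EQUIVALENT to invariance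
of K under all linear isometries (⇐: K = c|y|^(−2Δ) has ∂ₛ∂τ log K = 4Δsτ/(s²+τ²)² ≥ 0; ⇒: proved
inline in `closes`, continuity-free — the column-0 minor in the frame based at p(a−η) compares the
directions p(a), p(a+h) of a great circle and gives cos(η+h)^(2Δ)·K(p(a+h)) ≤ cos(η)^(2Δ)·K(p a); η
→ 0⁺ needs only the continuity of cos; the two-sided bound |log K(p(a+h)) − log K(p a)| ≤ −2Δ log
cos h = o(h) forces zero derivative along every great circle). Provers attack CriticalOrthantTP2
(rank 2) and the support, n -/
@[route_item "route-CriticalPhenomena-OrthogonalFrameTP2", crux]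
def LimitOrthantTP2 : Prop :=
  ∀ (ρ : ℝ → ℝ) (Δ : ℝ) (S : Literature.Probability.LatticeModels.CorrFamily 3), (∀ δ ∈ Set.Ioc (0:ℝ) 1, 0 < ρ δ) → 0 < Δ → Literature.Probability.LatticeModels.HasPointwiseScalingLimit (Literature.Probability.LatticeModels.criticalCorr 3) ρ S → Literature.Probability.LatticeModels.IsNondegenerateTwoPoint S → Literature.Probability.LatticeModels.IsTranslationInvariant S → Literature.Probability.LatticeModels.IsScaleCovariant Δ S → ∀ x w : EuclideanSpace ℝ (Fin 3), x ≠ 0 → inner ℝ x w = 0 → ∀ s t τ₁ τ₂ : ℝ, 0 < s → s ≤ t → 0 ≤ τ₁ → τ₁ ≤ τ₂ → S 2 ![0, t • x + τ₁ • w] * S 2 ![0, s • x + τ₂ • w] ≤ S 2 ![0, s • x + τ₁ • w] * S 2 ![0, t • x + τ₂ • w]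

/-- item stmt-CriticalPhenomena-16806 · support · rank 9 · open · by planner
sources: MessagerMiracleSoleJSP1977, DuminilCopin2019, AizenmanDuminilCopinAnnals2021
[support] limit passage: CriticalOrthantTP2 ⇒ for every pointwise scaling limit S of criticalCorr 3
(ρ > 0 on (0,1]) that is non-degenerate, translation invariant and scale covariant with Δ, the
kernel K(x) = S 2 (0,x) is Pythagorean-monotone: x ≠ 0, ⟪x,w⟫ = 0 ⇒ K(x+w) ≤ K(x). Proof: (i) unit
cells multiply to rectangles on the lattice (G > 0, criticalTwoPoint_bounds_holds); (ii) along δ =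
1/N with a_N = ⌊sN/‖u‖⌋, b_N = ⌊tN/‖v‖⌋ the lattice points a_N u − b_N v are exact lattice
approximations of x_N → sû − tv̂, and local uniform convergence + continuity of K off 0
(twoPointKernelOfLimit_proof) give TP₂ of k(s,t) = K(sû − tv̂) on the real quadrant for every
lattice-orthogonal frame; (iii) TP₂ ⇒ k(s,t')/k(s,t) is non-decreasing in s and tends to 1 as s → ∞
(homogeneity with c = s and continuity at û), hence ≤ 1: K(sû − tv̂) ≤ K(sû); (iv)
lattice-orthogonal frames (u/‖u‖, v/‖v‖) are dense among orthonormal pairs (integer directions are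
dense in S²; ℤ³ ∩ u^⊥ ⊇ span(u×e₁,u×e₂,u×e₃) has rank 2 and dense directions in the circle u^⊥ ∩
S²), and the inequality is closed under limits by continuity of K at x and x+w ≠ 0. [difficulty:
provable-now] -/
@[route_item "route-CriticalPhenomena-OrthogonalFrameTP2"]
def LimitKernelPythagorean : Prop :=
  CriticalOrthantTP2 → ∀ (ρ : ℝ → ℝ) (Δ : ℝ) (S : Literature.Probability.LatticeModels.CorrFamily 3), (∀ δ ∈ Set.Ioc (0:ℝ) 1, 0 < ρ δ) → Literature.Probability.LatticeModels.HasPointwiseScalingLimit (Literature.Probability.LatticeModels.criticalCorr 3) ρ S → Literature.Probability.LatticeModels.IsNondegenerateTwoPoint S → Literature.Probability.LatticeModels.IsTranslationInvariant S → Literature.Probability.LatticeModels.IsScaleCovariant Δ S → ∀ x w : EuclideanSpace ℝ (Fin 3), x ≠ 0 → inner ℝ x w = 0 → S 2 ![0, x + w] ≤ S 2 ![0, x]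

/-- item stmt-CriticalPhenomena-16807 · support · rank 9 · open · by planner
sources: MessagerMiracleSoleJSP1977, FrohlichEtAl1978, DuminilcopinPanis2025
[support] (shared item 1983, verbatim; PROVED in tree by
HyperoctahedralRPTwoPoint.twoPointKernelOfLimit_proof) for every non-degenerate,
translation-invariant, scale-covariant pointwise scaling limit S of criticalCorr 3 the kernel K x :=
S 2 (0,x) has 1/2 ≤ Δ ≤ 1, ContinuousOn K {0}ᶜ, K > 0 off 0, K(c•x) = c^(−2Δ) K x, invariance and
reflection positivity in the nine lattice mirrors. This route uses the first four clauses.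
[difficulty: provable-now] -/
@[route_item "route-CriticalPhenomena-OrthogonalFrameTP2"]
def TwoPointKernelOfLimit : Prop :=
  ∀ (ρ : ℝ → ℝ) (Δ : ℝ) (S : Literature.Probability.LatticeModels.CorrFamily 3), (∀ δ ∈ Set.Ioc (0:ℝ) 1, 0 < ρ δ) → Literature.Probability.LatticeModels.HasPointwiseScalingLimit (Literature.Probability.LatticeModels.criticalCorr 3) ρ S → Literature.Probability.LatticeModels.IsNondegenerateTwoPoint S → Literature.Probability.LatticeModels.IsTranslationInvariant S → Literature.Probability.LatticeModels.IsScaleCovariant Δ S → (1/2 ≤ Δ ∧ Δ ≤ 1) ∧ ContinuousOn (fun x : EuclideanSpace ℝ (Fin 3) => S 2 ![0, x]) {0}ᶜ ∧ (∀ x : EuclideanSpace ℝ (Fin 3), x ≠ 0 → 0 < S 2 ![0, x]) ∧ (∀ c : ℝ, 0 < c → ∀ x : EuclideanSpace ℝ (Fin 3), S 2 ![0, c • x] = c ^ (-(2 * Δ)) * S 2 ![0, x]) ∧ (∀ n : EuclideanSpace ℝ (Fin 3), (∃ i j : Fin 3, i ≠ j ∧ (n = EuclideanSpace.single i 1 ∨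 n = EuclideanSpace.single i 1 + EuclideanSpace.single j 1 ∨ n = EuclideanSpace.single i 1 - EuclideanSpace.single j 1)) → (∀ x : EuclideanSpace ℝ (Fin 3), S 2 ![0, ((ℝ ∙ n)ᗮ).reflection x] = S 2 ![0, x]) ∧ (∀ (m : ℕ) (p : Fin m → EuclideanSpace ℝ (Fin 3)) (c : Fin m → ℝ), (∀ a, 0 < inner ℝ (p a) n) → 0 ≤ ∑ a, ∑ b, c a * c b * S 2 ![0, p a - ((ℝ ∙ n)ᗮ).reflection (p b)]))

-- earlier PythagoreanRigidity (stmt-CriticalPhenomena-16805, replaced 2026-08-16T20:54:10Z -> stmt-CriticalPhenomena-16809): retired by None — ∀ (Δ : ℝ) (K : EuclideanSpace ℝ (Fin 3) → ℝ), 0 < Δ → ContinuousOn K {0}ᶜ → (∀ x, x ≠ 0 → 0 < K x) → (∀ c : ℝ, 0 < c → ∀ x, K (c • x) = c ^ (-(2 * Δ)) * K x) → (∀ x w : EuclideanSpace ℝ (Fin 3), x ≠ 0 → inner ℝ x w = 0 → K (x + w) ≤ K x) → ∀ (R : EuclideanSpa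
/-- item stmt-CriticalPhenomena-16809 · support · rank 9 · open · by planner
sources: Schoenberg1951, Karlin1968, Hegerfeldt1977
continuum rigidity, minimal form (continuity hypothesis dropped: the great-circle chaining uses only
positivity, homogeneity and Pythagorean monotonicity): K > 0 off 0, K(cx) = c^(-2Δ)K(x), x ⊥ w ⇒
K(x+w) ≤ K(x) ⇒ K(Rx) = K(x) for every linear isometry R and x ≠ 0. -/
@[route_item "route-CriticalPhenomena-OrthogonalFrameTP2"]
def PythagoreanRigidity : Prop :=
  ∀ (Δ : ℝ) (K : EuclideanSpace ℝ (Fin 3) → ℝ), 0 < Δ → (∀ x, x ≠ 0 → 0 < K x) → (∀ c : ℝ, 0 < c → ∀ x, K (c • x) = c ^ (-(2 * Δ)) * K x) → (∀ x w : EuclideanSpace ℝ (Fin 3), x ≠ 0 → inner ℝ x w = 0 → K (x + w) ≤ K x) → ∀ (R : EuclideanSpace ℝ (Fin 3) ≃ₗᵢ[ℝ] EuclideanSpace ℝ (Fin 3)) (x : EuclideanSpace ℝ (Fin 3)), x ≠ 0 → K (R x) = K x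

/-- item stmt-CriticalPhenomena-17190 · support · rank 9 · open · by planner
sources: MessagerMiracleSoleJSP1977, DuminilCopin2019, AizenmanDuminilCopinAnnals2021
[support, provable-now] the two-layer edge CriticalOrthantTP2 → LimitOrthantTP2 (limit passage): (i)
one lattice cell (a,b) of CriticalOrthantTP2 in the exactly orthogonal integer frame u = A·[y/δ], v
= A·[w′/δ] − B·[y/δ] (A = |[y/δ]|², B = ⟨[y/δ],[w′/δ]⟩, so Σ uᵢvᵢ = 0 over ℤ; u, v ≠ 0 for small δ
because (δ/A)·u → y ≠ 0 and (δ/A)·v → w′, the case w′ = 0 being trivial), read at mesh ε = δ/A where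
ε·p is an exact lattice configuration (latticeApprox ε (ε•p) = p, first point 0, criticalCorr_two),
converges as δ → 0⁺ — locally uniform convergence of rescaledCorrelator (criticalCorr 3) ρ 2 near
(0, target) plus continuity of S 2 off the diagonal, AUTOMATIC for every pointwise limit (tree,
importable: RotationUpgradeFromTwoPointNegative.limit_continuousOn / continuousOn_of_limit in
Theorems/RotationUpgradeFromTwoPoint/Negative/ContinuityFree.lean; or re-derived from
IsTranslationInvariant S by the cellmate shift as in the evidence file on
stmt-CriticalPhenomena-16806) — to the unit continuum cell K((a+1)y + b w′)·K(a y + (b+1) w′) ≤ K(a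
y + b w′)·K((a+1)y + (b+1)w′) for all real y ≠ 0 ⊥ w′, a ≥ 1, b ≥ 0; (ii) continuum cells multiply
to rectangles because K > 0 off 0 (IsNondegenerateTw -/
@[route_item "route-CriticalPhenomena-OrthogonalFrameTP2"]
def OrthantTP2LimitPassage : Prop :=
  CriticalOrthantTP2 → LimitOrthantTP2

/-- item stmt-CriticalPhenomena-16808 · assembly · rank 1 · open · by planner
sources: DuminilCopinICM2022, AizenmanDuminilCopinAnnals2021
[assembly] CriticalOrthantTP2 → PythagoreanRigidity → LimitKernelPythagorean → TwoPointKernelOfLimit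
→ RotationUpgradeFromTwoPoint → ExistsScaleCovariantLimit → InversionUpgradeNormalised →
IsingEuclidUpgradeR4NonGaussian → Ising3DConformalLimit (proved sorry-free as `assembly_holds` in
the planner's Sketch.lean; the deciding theorem `closes` applies it). -/
@[route_item "route-CriticalPhenomena-OrthogonalFrameTP2"]
def Assembly : Prop :=
  CriticalOrthantTP2 → PythagoreanRigidity → LimitKernelPythagorean → TwoPointKernelOfLimit → RotationUpgradeFromTwoPoint → ExistsScaleCovariantLimit → InversionUpgradeNormalised → IsingEuclidUpgradeR4NonGaussian → Ising3DConformalLimit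

/-! D-0027 §2.1 — DECIDING THEOREM (planner-authored via `route open/edit --closes-file`; by planner-rbadge-CriticalPhenomena-OrthogonalFra-d4e304f5-g2-0 2026-08-16T22:55:06Z):
its hypotheses are this route's items and its conclusion the sub-problem Statement (glue_lint), and it elaborates with this file. -/

/-- DECIDING THEOREM of route OrthogonalFrameTP2 (D-0027 §2.1; rev 5 = glue repair 2026-08-16): CRUX-ONLY binders
`LimitOrthantTP2` (r7, the scaling-limit shadow of `CriticalOrthantTP2`, reached from it by the support `OrthantTP2LimitPassage`),
`RotationUpgradeFromTwoPoint`, `ExistsScaleCovariantLimit`, `InversionUpgradeNormalised`, `IsingEuclidUpgradeR4NonGaussian`;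
conclusion `_root_.Ising3DConformalLimit` by name; no import outside the Statement cone. Logic: `(ρ, Δ, S)` from
`ExistsScaleCovariantLimit`; positivity / homogeneity of `K x = S 2 (0,x)` from non-degeneracy / scale covariance; the column-0
TP₂ minors of `LimitOrthantTP2` feed the inline continuity-free rigidity lemma `hPR` (sliding base point on a great circle,
`η → 0⁺`, zero derivative of `θ ↦ log K (p θ)`, a unit normal to `x, R x` in `ℝ³`), so `K` is invariant under linear isometries;
then `RotationUpgradeFromTwoPoint`, translations, `InversionUpgradeNormalised` give `IsMoebiusCovariant Δ S` and
`IsingEuclidUpgradeR4NonGaussian` gives `HasNontrivialU4 S`. Axioms propext/Classical.choice/Quot.sound. -/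
@[closes "route-CriticalPhenomena-OrthogonalFrameTP2"] theorem closes (hTP : LimitOrthantTP2) (hROT : RotationUpgradeFromTwoPoint)
  (hC : ExistsScaleCovariantLimit) (hD : InversionUpgradeNormalised)
  (hE : IsingEuclidUpgradeR4NonGaussian) : _root_.Ising3DConformalLimit := by
 obtain ⟨ρ, Δ, S, hρ, hΔ, hl, hn, hnd, htr, hsc⟩ := hC
 have hPR : ∀ K : EuclideanSpace ℝ (Fin 3) → ℝ, (∀ x, x ≠ 0 → 0 < K x) →
   (∀ c : ℝ, 0 < c → ∀ x, K (c • x) = c ^ (-(2 * Δ)) * K x) →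
   (∀ x w : EuclideanSpace ℝ (Fin 3), x ≠ 0 → ⟪x, w⟫_ℝ = 0 → ∀ s t : ℝ, 0 < s → s ≤ t →
     K (t • x) * K (s • x + w) ≤ K (s • x) * K (t • x + w)) →
   ∀ (R : EuclideanSpace ℝ (Fin 3) ≃ₗᵢ[ℝ] EuclideanSpace ℝ (Fin 3)) x, x ≠ 0 → K (R x) = K x := by
  intro K h0 hh hW
  have h1 : ∀ e f : EuclideanSpace ℝ (Fin 3), ‖e‖ = 1 → ‖f‖ = 1 → ⟪e, f⟫_ℝ = 0 → ∀ a h : ℝ, 0 < h → h < Real.pi / 2 →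
    2 * Δ * Real.log (Real.cos h) + Real.log (K (Real.cos (a + h) • e + Real.sin (a + h) • f))
      ≤ Real.log (K (Real.cos a • e + Real.sin a • f)) := by
   intro e f he hf hef a h h0' hh2
   set p : ℝ → EuclideanSpace ℝ (Fin 3) := fun θ => Real.cos θ • e + Real.sin θ • f with hp
   show 2 * Δ * Real.log (Real.cos h) + Real.log (K (p (a + h))) ≤ Real.log (K (p a))
   have hi : ∀ a b, ⟪p a, p b⟫_ℝ = Real.cos (a - b) := fun a b => by
    simp [hp, inner_add_left, inner_add_right, real_inner_smul_left, real_inner_smul_right, he, hf,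
     hef, real_inner_comm e f, Real.cos_sub]; ring
   have hu : ∀ a, ‖p a‖ ^ 2 = 1 := fun a => by rw [← real_inner_self_eq_norm_sq, hi, sub_self, Real.cos_zero]
   have hn : ∀ a, p a ≠ 0 := fun a h => by simpa [h] using hu a
   have hrot : ∀ b θ, p (b + θ) = Real.cos θ • p b + Real.sin θ • p (b + Real.pi / 2) := by
    intro b θ; simp only [hp, Real.cos_add, Real.sin_add, Real.cos_pi_div_two, Real.sin_pi_div_two]; module
   have hI : ∀ s : ℝ, 0 < s → (1 + s) * h < Real.pi / 2 →
     2 * Δ * Real.log (Real.cos ((1 + s) * h)) + Real.log (K (p (a + h)))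
       ≤ 2 * Δ * Real.log (Real.cos (s * h)) + Real.log (K (p a)) := by
    intro s hs hsh
    set η := s * h with hη
    set b := a - η with hb
    have hη0 : 0 < η := mul_pos hs h0'
    have hηh : (1 + s) * h = η + h := by rw [hη]; ring
    rw [hηh] at hsh ⊢
    have cη : 0 < Real.cos η := Real.cos_pos_of_mem_Ioo ⟨by linarith, by linarith⟩
    have cηh : 0 < Real.cos (η + h) := Real.cos_pos_of_mem_Ioo ⟨by linarith, hsh⟩
    have tη : 0 < Real.tan η := Real.tan_pos_of_pos_of_lt_pi_div_two hη0 (by linarith)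
    have tle : Real.tan η ≤ Real.tan (η + h) :=
     (Real.tan_lt_tan_of_lt_of_lt_pi_div_two (by linarith) hsh (by linarith)).le
    have tηh : 0 < Real.tan (η + h) := lt_of_lt_of_le tη tle
    have ha : p a = p (b + η) := by rw [hb, sub_add_cancel]
    have hah : p (a + h) = p (b + (η + h)) := by rw [hb]; congr 1; ring
    set w := Real.tan η • ((1 / Real.cos (η + h)) • p (b + (η + h)) - p b) with hw
    have hi' : ∀ a t, ⟪p a, p (a + t)⟫_ℝ = Real.cos t := fun a t => by
     rw [hi, sub_add_cancel_left, Real.cos_neg]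
    have horth : ⟪p b, w⟫_ℝ = 0 := by
     rw [hw, real_inner_smul_right, inner_sub_right, real_inner_smul_right, hi', hi, sub_self,
      Real.cos_zero, one_div, inv_mul_cancel₀ cηh.ne', sub_self, mul_zero]
    have key := hW (p b) w (hn b) horth (Real.tan η) (Real.tan (η + h)) tη tle
    have e1 : Real.tan η • p b + w = (Real.tan η / Real.cos (η + h)) • p (b + (η + h)) := by
     rw [hw]; module
    have e2 : Real.tan (η + h) • p b + w = (Real.tan (η + h) / Real.cos η) • p (b + η) := by
     rw [hw, hrot b (η + h), hrot b η]
     simp only [Real.tan_eq_sin_div_cos]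
     match_scalars <;> field_simp <;> ring
    rw [e1, e2, ← ha, ← hah] at key
    have hlog : ∀ c : ℝ, 0 < c → ∀ v, v ≠ 0 → Real.log (K (c • v)) = -(2 * Δ) * Real.log c + Real.log (K v) :=
     fun c hc v hv => by
      rw [hh c hc, Real.log_mul (Real.rpow_pos_of_pos hc _).ne' (h0 v hv).ne', Real.log_rpow hc]
    have n1 : Real.tan (η + h) • p b ≠ 0 := smul_ne_zero tηh.ne' (hn b)
    have n2 : (Real.tan η / Real.cos (η + h)) • p (a + h) ≠ 0 := smul_ne_zero (div_pos tη cηh).ne' (hn _)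
    have n3 : Real.tan η • p b ≠ 0 := smul_ne_zero tη.ne' (hn b)
    have n4 : (Real.tan (η + h) / Real.cos η) • p a ≠ 0 := smul_ne_zero (div_pos tηh cη).ne' (hn _)
    have := Real.log_le_log (mul_pos (h0 _ n1) (h0 _ n2)) key
    rw [Real.log_mul (h0 _ n1).ne' (h0 _ n2).ne', Real.log_mul (h0 _ n3).ne' (h0 _ n4).ne',
     hlog _ tηh _ (hn b), hlog _ (div_pos tη cηh) _ (hn _), hlog _ tη _ (hn b),
     hlog _ (div_pos tηh cη) _ (hn a), Real.log_div tη.ne' cηh.ne', Real.log_div tηh.ne' cη.ne'] at this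
    ring_nf at this ⊢
    linarith
   have hc : 0 < Real.cos h := Real.cos_pos_of_mem_Ioo ⟨by linarith, hh2⟩
   refine le_of_tendsto_of_tendsto (b := 𝓝[>] (0:ℝ))
    (f := fun s => 2 * Δ * Real.log (Real.cos ((1 + s) * h)) + Real.log (K (p (a + h))))
    (g := fun s => 2 * Δ * Real.log (Real.cos (s * h)) + Real.log (K (p a))) ?_ ?_ ?_
   · have : ContinuousAt (fun s : ℝ => 2 * Δ * Real.log (Real.cos ((1 + s) * h)) + Real.log (K (p (a + h)))) 0 := by
      fun_prop (disch := norm_num [hc.ne'])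
     simpa using this.tendsto.mono_left nhdsWithin_le_nhds
   · have : ContinuousAt (fun s : ℝ => 2 * Δ * Real.log (Real.cos (s * h)) + Real.log (K (p a))) 0 := by
      fun_prop (disch := norm_num)
     simpa using this.tendsto.mono_left nhdsWithin_le_nhds
   · filter_upwards [Ioo_mem_nhdsGT (show (0:ℝ) < (Real.pi / 2 - h) / h from div_pos (by linarith) h0')]
      with s hs
     refine hI s hs.1 ?_
     have := hs.2; rw [lt_div_iff₀ h0'] at this; nlinarith
  have hB : ∀ e f : EuclideanSpace ℝ (Fin 3), ‖e‖ = 1 → ‖f‖ = 1 → ⟪e, f⟫_ℝ = 0 → K f = K e := by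
   intro e f he hf hef
   set g : ℝ → ℝ := fun θ => Real.log (K (Real.cos θ • e + Real.sin θ • f)) with hg
   have hS : ∀ a h, h ∈ Ioo (-(Real.pi / 2)) (Real.pi / 2) → 2 * Δ * Real.log (Real.cos h) + g (a + h) ≤ g a := by
    intro a h hh
    rcases lt_trichotomy h 0 with hlt | rfl | hgt
    · have := h1 e (-f) he (by rwa [norm_neg]) (by rw [inner_neg_right, hef, neg_zero]) (-a) (-h)
       (neg_pos.2 hlt) (by linarith [hh.1])
      rw [show -a + -h = -(a + h) by ring, Real.cos_neg, Real.cos_neg, Real.cos_neg, Real.sin_neg,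
       Real.sin_neg] at this
      simpa [hg] using this
    · simp [hg]
    · exact h1 e f he hf hef a h hgt hh.2
   have hψ : (fun h => Real.log (Real.cos h)) =o[𝓝 0] fun h => h := by
    simpa using hasDerivAt_iff_isLittleO_nhds_zero.1 ((Real.hasDerivAt_cos 0).log (by simp))
   have hd : ∀ a, HasDerivAt g 0 a := fun a => by
    rw [hasDerivAt_iff_isLittleO_nhds_zero]
    simp only [smul_zero, sub_zero]
    refine Asymptotics.IsBigO.trans_isLittleO ?_ hψ
    refine Asymptotics.IsBigO.of_bound (2 * Δ) ?_
    filter_upwards [Ioo_mem_nhds (show -(Real.pi / 2) < (0:ℝ) by linarith [Real.pi_pos])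
     (show (0:ℝ) < Real.pi / 2 by positivity)] with h hh
    have l1 := hS a h hh
    have l2 := hS (a + h) (-h) ⟨by linarith [hh.2], by linarith [hh.1]⟩
    rw [Real.cos_neg, add_neg_cancel_right] at l2
    simp only [Real.norm_eq_abs, abs_le]
    constructor <;> nlinarith [neg_le_abs (Real.log (Real.cos h)), hΔ.le]
   have hc := is_const_of_deriv_eq_zero (fun a => (hd a).differentiableAt)
    (fun a => (hd a).deriv) (Real.pi / 2) 0
   simp [hg] at hc
   have he0 : e ≠ 0 := fun h => by simp [h] at he
   have hf0 : f ≠ 0 := fun h => by simp [h] at hf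
   exact Real.log_injOn_pos (h0 _ hf0) (h0 _ he0) hc
  intro R x hx
  obtain ⟨n, hn1, hxn, hyn⟩ : ∃ n, ‖n‖ = 1 ∧ ⟪x, n⟫_ℝ = 0 ∧ ⟪R x, n⟫_ℝ = 0 := by
   have h1 := (finrank_span_le_card (R := ℝ) ({x, R x} : Set _)).trans
    (by simpa using (Finset.card_le_two : ({x, R x} : Finset _).card ≤ 2))
   have h2 := Submodule.finrank_add_finrank_orthogonal (Submodule.span ℝ {x, R x})
   rw [finrank_euclideanSpace_fin] at h2
   obtain ⟨n, hn, hn0⟩ := (Submodule.ne_bot_iff (Submodule.span ℝ {x, R x})ᗮ).1 fun h => by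
    rw [← Submodule.finrank_eq_zero] at h; omega
   refine ⟨‖n‖⁻¹ • n,
    by rw [norm_smul, norm_inv, norm_norm, inv_mul_cancel₀ (norm_ne_zero_iff.2 hn0)], ?_, ?_⟩ <;>
    rw [real_inner_smul_right, Submodule.inner_right_of_mem_orthogonal (Submodule.subset_span (by simp)) hn,
     mul_zero]
  have key : ∀ z, z ≠ 0 → ⟪z, n⟫_ℝ = 0 → K z = ‖z‖ ^ (-(2 * Δ)) * K n := fun z hz hzn => by
   have hz' := norm_ne_zero_iff.2 hz
   rw [← hB n (‖z‖⁻¹ • z) hn1 (by rw [norm_smul, norm_inv, norm_norm, inv_mul_cancel₀ hz'])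
    (by rw [real_inner_smul_right, real_inner_comm, hzn, mul_zero]), ← hh _ (norm_pos_iff.2 hz),
    smul_smul, mul_inv_cancel₀ hz', one_smul]
  rw [key _ (by rw [← norm_ne_zero_iff, R.norm_map, norm_ne_zero_iff]; exact hx) hyn,
   key x hx hxn, R.norm_map]
 have h0pair : ∀ {z : EuclideanSpace ℝ (Fin 3)}, z ≠ 0 →
   (![0, z] : Fin 2 → EuclideanSpace ℝ (Fin 3)) ∈ Literature.Probability.LatticeModels.NonCoincident 3 2 := by
  intro z hz
  rw [Literature.Probability.LatticeModels.mem_nonCoincident]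
  intro i j hij
  fin_cases i <;> fin_cases j
  · rfl
  · exact absurd hij.symm hz
  · exact absurd hij hz
  · rfl
 have hpos : ∀ z : EuclideanSpace ℝ (Fin 3), z ≠ 0 → 0 < S 2 ![0, z] := fun z hz => hnd _ (h0pair hz)
 have hhom : ∀ c : ℝ, 0 < c → ∀ z : EuclideanSpace ℝ (Fin 3), S 2 ![0, c • z] = c ^ (-(2 * Δ)) * S 2 ![0, z] := by
  intro c hc z
  have h := hsc 2 c hc ![0, z]
  have hcfg : (fun i => c • (![0, z] : Fin 2 → EuclideanSpace ℝ (Fin 3)) i) = ![0, c • z] := by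
   funext i; fin_cases i <;> simp
  rw [hcfg] at h
  rw [h]; norm_num
 have h2 := hPR (fun q => S 2 ![0, q]) hpos hhom (fun x w hx hxw s t hs hst => by
  simpa only [zero_smul, add_zero, one_smul] using
   hTP ρ Δ S hρ hΔ hl hnd htr hsc x w hx hxw s t 0 1 hs hst le_rfl zero_le_one)
 have hrot := hROT ρ Δ S hρ hl hn hnd htr hsc h2
 exact ⟨ρ, Δ, S, hρ, hΔ, hl, hnd, ⟨⟨htr, hrot⟩, hsc, hD ρ Δ S hρ hl hn hnd ⟨htr, hrot⟩ hsc⟩,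
  hE ρ S hρ hl hnd⟩

end Summit.CriticalPhenomena.Ising3DConformalLimit.Theses.OrthogonalFrameTP2
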